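import Mathlib
import HarnessLib
import Literature.Probability.Percolation.AltFourArmOfCrossingLoops
import Literature.Probability.RandomPlanarGeometry.LoopConfigurations
import Summits.CriticalPhenomena.CardyFormulaZ2.Theorems.CardyMagicRigidityMagicFormulaTLoopReflection
import Summits.CriticalPhenomena.CardyFormulaZ2.Theorems.CardyMagicRigidityNestingRigidityBigLoopsTightT

/-!
# Two close macroscopic interface loops force four alternating arms (crux `MagicFormulaT`)

Crux `Summit.CriticalPhenomena.CardyFormulaZ2.Theses.CardyMagicRigidity.MagicFormulaT`
(stmt-CriticalPhenomena-4836), line `Sketch` (skeleton v7), registered sub-goal `ribbon_armsAt` of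
the skeleton stub `stub_ribbonRarity` (RIBBON RARITY, the Peierls estimate for pairs of globally
close macroscopic loops in critical site percolation on `δ𝕋`). This file is the DETERMINISTIC
percolation geometry of one link of the Peierls chain:

*if two distinct interface loops `u ≠ v` of `siteLoopConfig δ ω`, both of trace-diameter `≥ M ε`
(`M ≥ 40`, `ε ≥ 100 δ`), are at DKKMO loop distance `udist u v ≤ 2ε`, then around every point `p`
within `ε` of the trace of `u` the configuration has four ALTERNATING arms across the hexagonal
annulus of lattice radii `r₁ ≤ r₂` (`5ε ≤ δ r₁`, `δ r₂ ≤ M ε / 4`) centred at the site `c` of `𝕋`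
next to `p`.*

Indeed `u` and `v` are the polygons of interface loops `γ₁, γ₂` of `ω` (`IsSiteInterfaceLoop`),
whose traces `polyTrace δ γᵢ` are DISJOINT (distinct loops of one configuration have distinct,
hence disjoint, traces: `polyTrace_ne_of_unbasedLoop_ne`, `IsSiteInterfaceLoop.polyTrace_eq_or_disjoint`);
both traces come within `3ε + 2δ` of the mesh point `triMeshPoint δ c` (the loop distance dominates
the Hausdorff distance of the traces) and reach distance `≥ M ε / 4 + 17 δ` from it (diameter
`≥ M ε`), so each crosses the round shell in between, and two disjoint interface crossings (in and
out, twice) give four alternating arms (`mem_altFourArm_of_two_crossing_traces`,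
`AltFourArmOfCrossingLoops.lean`). The tree's arm event `altFourArm r₁ r₂` is centred at the
origin, so the conclusion is stated for the configuration reflected through the site `c`,
`(Equiv.subLeft c) '' ω = {c − x | x ∈ ω}` (c1's reflection kit,
`CardyMagicRigidityMagicFormulaTLatticeReflection` / `…LoopReflection`): the face reflection
`ρH[c]` maps interface loops of `ω` to interface loops of the reflected configuration
(`isSiteInterfaceLoop_reflect`), and acts on the polygon traces at mesh `δ` as the point reflection
`z ↦ triMeshPoint δ c − z` of `ℂ` (`polyTrace_map_reflect`, proved here), an isometry sending
`triMeshPoint δ c` to the origin.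

Everything is proved from tree / Mathlib material; no definition and no named fact is introduced
(the face reflection is the local notation `ρH[c]`, as in the reflection kit).
-/

noncomputable section

namespace Summit.CriticalPhenomena.CardyFormulaZ2.Cruxes.MagicFormulaT.LineSketch

open MeasureTheory Filter Set
open scoped Real Topology BigOperators ENNReal
open Literature.Probability.RandomPlanarGeometry Literature.Probability.Percolation
  Literature.Probability.LatticeModels
open Summit.CriticalPhenomena.CardyFormulaZ2.Cruxes.NestingRigidity.MarkovCascadeOneGeneration

/-- The face reflection through `triEmbed c / 2`, as a graph endomorphism of the honeycomb
lattice (local notation, not a definition; see `hexGraph_adj_reflect`). -/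
local notation3 "ρH[" c "]" =>
  (⟨fun F : HexVertex ↦ ((c : Site 2) - F.1 - 1, Fin.rev F.2), fun h ↦ hexGraph_adj_reflect c h⟩ :
    hexGraph →g hexGraph)

/-! ## The polygon of the reflected walk at mesh `δ` -/

/-- Point reflections of `ℂ` map segments to segments: `(a − ·) '' [x, y] = [a − x, a − y]`. -/
theorem image_sub_segment (a x y : ℂ) :
    (fun z ↦ a - z) '' segment ℝ x y = segment ℝ (a - x) (a - y) := by
  simpa using image_segment ℝ (AffineMap.const ℝ ℂ a - AffineMap.id ℝ ℂ) x y

/-- The vertices of the polygon at mesh `δ` of the reflected walk `γ.map ρH[c]` are the point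
reflections through `triMeshPoint δ c` of the vertices of the polygon of `γ`. -/
theorem polyPt_map_reflect (δ : ℝ) (c : Site 2) {F G : HexVertex} (γ : hexGraph.Walk F G) (i : ℕ) :
    polyPt δ (γ.map ρH[c]) i = triMeshPoint δ c - polyPt δ γ i := by
  rw [polyPt, polyPt, SimpleGraph.Walk.getVert_map, reflectHom_apply, hexCenter_reflect, triMeshPoint,
    mul_sub]

/-- The dart pieces of the polygon of the reflected walk are the reflected dart pieces. -/
theorem polyPiece_map_reflect (δ : ℝ) (c : Site 2) {F G : HexVertex} (γ : hexGraph.Walk F G) (i : ℕ) :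
    polyPiece δ (γ.map ρH[c]) i = (fun z ↦ triMeshPoint δ c - z) '' polyPiece δ γ i := by
  rw [polyPiece, polyPiece, polyPt_map_reflect, polyPt_map_reflect, image_sub_segment]

/-- **The trace of the polygon at mesh `δ` of the reflected walk is the point reflection through
`triMeshPoint δ c` of the trace of the polygon of the walk.** -/
theorem polyTrace_map_reflect (δ : ℝ) (c : Site 2) {F G : HexVertex} (γ : hexGraph.Walk F G) :
    polyTrace δ (γ.map ρH[c]) = (fun z ↦ triMeshPoint δ c - z) '' polyTrace δ γ := by
  rw [polyTrace, polyTrace, Set.image_iUnion₂, SimpleGraph.Walk.length_map]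
  exact Set.iUnion₂_congr fun i _ ↦ polyPiece_map_reflect δ c γ i

/-- Disjoint sets have disjoint point reflections. -/
theorem disjoint_image_sub {a : ℂ} {A B : Set ℂ} (h : Disjoint A B) :
    Disjoint ((fun z ↦ a - z) '' A) ((fun z ↦ a - z) '' B) :=
  (Set.disjoint_image_iff sub_right_injective).2 h

/-! ## Far points of a set of large diameter -/

/-- A set of diameter `≥ D` has, for every centre `a` and every radius `0 ≤ R` with `2R < D`, a
point at distance `≥ R` from `a` (otherwise all pairwise distances would be `≤ 2R < D`). -/
theorem exists_le_dist_of_le_diam {S : Set ℂ} {a : ℂ} {R D : ℝ} (hD : D ≤ Metric.diam S)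
    (hRD : 2 * R < D) (hR : 0 ≤ R) : ∃ z ∈ S, R ≤ dist a z := by
  by_contra h
  push Not at h
  have : Metric.diam S ≤ 2 * R :=
    Metric.diam_le_of_forall_dist_le (by linarith) fun x hx y hy ↦ by
      have hx' := h x hx
      have hy' := h y hy
      linarith [dist_triangle x a y, dist_comm a x]
  linarith

/-! ## The stub -/

/-- **Sub-goal `ribbon_armsAt` of stub `stub_ribbonRarity` (line `Sketch`, crux `MagicFormulaT`):
two distinct, `2ε`-close interface loops of `siteLoopConfig δ ω` of diameter `≥ M ε` force, around
every point `p` within `ε` of the first trace, four alternating arms of the configuration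
reflected through the neighbouring site `c` (`dist (triMeshPoint δ c) p ≤ 2δ`), across every
hexagonal annulus of lattice radii `r₁ ≤ r₂` with `5ε ≤ δ r₁` and `δ r₂ ≤ M ε / 4`
(`0 < δ`, `100 δ ≤ ε`, `40 ≤ M`).**

Proof: write `u, v` as polygons of interface loops `γ₁, γ₂` of `ω` (disjoint traces), reflect
through `c` (`isSiteInterfaceLoop_reflect`, `polyTrace_map_reflect`), and apply
`mem_altFourArm_of_two_crossing_traces` to the reflected loops with `ρ = 3ε + 2δ`,
`q₁ = 3ε + 10δ`, `q₂ = M ε / 4 + 9δ`, `R = M ε / 4 + 17δ`: the near points come from a point of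
`u.range` within `ε` of `p` (the infimum distance to the compact trace is attained) and a point of
`v.range` within `udist u v ≤ 2ε` of it; the far points from the diameter bound
(`exists_le_dist_of_le_diam`); the radii fit since `√3 ≥ 3/2`. -/
theorem ribbon_armsAt : ∀ (δ ε : ℝ) (M r₁ r₂ : ℕ) (ω : SiteConfig (Site 2)) (u v : UnbasedLoop ℂ) (p : ℂ) (c : Site 2), 0 < δ → 100 * δ ≤ ε → 40 ≤ M → u ∈ (siteLoopConfig δ ω).loops → v ∈ (siteLoopConfig δ ω).loops → u ≠ v → u.udist v ≤ 2 * ε → Metric.infDist p u.range ≤ ε → (M : ℝ) * ε ≤ Metric.diam u.range → (M : ℝ) * ε ≤ Metric.diam v.range → dist (triMeshPoint δ c) p ≤ 2 * δ → 5 * ε ≤ δ * r₁ → δ * r₂ ≤ M * ε / 4 → r₁ ≤ r₂ → (Equiv.subLeft c) '' ω ∈ altFourArm r₁ r₂ := by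
  intro δ ε M r₁ r₂ ω u v p c hδ hδε hM hu hv huv hud hp hdu hdv hcp hr₁ hr₂ hr
  -- (a) the two loops are polygons of interface loops of `ω` with disjoint traces
  obtain ⟨F₁, γ₁, hγ₁, hu₁⟩ := exists_walk_of_mem_loops_siteLoopConfig hu
  obtain ⟨F₂, γ₂, hγ₂, hv₂⟩ := exists_walk_of_mem_loops_siteLoopConfig hv
  have hur : u.range = polyTrace δ γ₁ := by
    rw [← hu₁]
    exact range_mk_siteLoopCurve_eq_polyTrace hγ₁
  have hvr : v.range = polyTrace δ γ₂ := by
    rw [← hv₂]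
    exact range_mk_siteLoopCurve_eq_polyTrace hγ₂
  have hne : polyTrace δ γ₁ ≠ polyTrace δ γ₂ :=
    polyTrace_ne_of_unbasedLoop_ne hδ.ne' hγ₁ hγ₂ (by rwa [hu₁, hv₂])
  have hdis : Disjoint (polyTrace δ γ₁) (polyTrace δ γ₂) :=
    (hγ₁.polyTrace_eq_or_disjoint hδ.ne' hγ₂).resolve_left hne
  -- near points: `z ∈ u.range` within `ε` of `p`, `y ∈ v.range` within `2ε` of `z`
  obtain ⟨z, hz, hpz⟩ := u.isCompact_range.exists_infDist_eq_dist u.range_nonempty p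
  obtain ⟨y, hy, hzy⟩ := UnbasedLoop.exists_mem_range_dist_le u v hz
  have hpz' : dist p z ≤ ε := by
    rw [← hpz]
    exact hp
  rw [hur] at hz hdu
  rw [hvr] at hy hdv
  have hε : 0 ≤ ε := by linarith
  have hM' : (40 : ℝ) ≤ M := by exact_mod_cast hM
  have hMε : 10 * ε ≤ (M : ℝ) * ε / 4 := by nlinarith
  have haz : dist (triMeshPoint δ c) z ≤ 2 * δ + ε := by
    linarith [dist_triangle (triMeshPoint δ c) p z]
  have hay : dist (triMeshPoint δ c) y ≤ 2 * δ + 3 * ε := by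
    linarith [dist_triangle (triMeshPoint δ c) z y]
  -- far points: both traces have diameter `≥ M ε > 2 (M ε / 4 + 17 δ)`
  have hR : 0 ≤ (M : ℝ) * ε / 4 + 17 * δ := by linarith
  have hRD : 2 * ((M : ℝ) * ε / 4 + 17 * δ) < (M : ℝ) * ε := by linarith
  obtain ⟨z', hz', haz'⟩ := exists_le_dist_of_le_diam (a := triMeshPoint δ c) hdu hRD hR
  obtain ⟨y', hy', hay'⟩ := exists_le_dist_of_le_diam (a := triMeshPoint δ c) hdv hRD hR
  -- (b) reflect through `c`: interface loops of the reflected configuration, disjoint traces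
  have hγ₁' := isSiteInterfaceLoop_reflect c hγ₁
  have hγ₂' := isSiteInterfaceLoop_reflect c hγ₂
  have hdis' : Disjoint (polyTrace δ (γ₁.map ρH[c])) (polyTrace δ (γ₂.map ρH[c])) := by
    rw [polyTrace_map_reflect, polyTrace_map_reflect]
    exact disjoint_image_sub hdis
  have hmem : ∀ {F : HexVertex} (γ : hexGraph.Walk F F) {x : ℂ}, x ∈ polyTrace δ γ →
      triMeshPoint δ c - x ∈ polyTrace δ (γ.map ρH[c]) := by
    intro F γ x hx
    rw [polyTrace_map_reflect]
    exact Set.mem_image_of_mem _ hx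
  have hnorm : ∀ x : ℂ, ‖triMeshPoint δ c - x‖ = dist (triMeshPoint δ c) x :=
    fun x ↦ (dist_eq_norm (triMeshPoint δ c) x).symm
  -- `√3 ≥ 3/2`
  have hs3 : (3 / 2 : ℝ) ≤ Real.sqrt 3 := by
    rw [Real.le_sqrt (by norm_num) (by norm_num)]
    norm_num
  -- (c) four alternating arms around the origin of the reflected configuration
  refine mem_altFourArm_of_two_crossing_traces hγ₁' hγ₂' hδ hdis'
    (ρ := 3 * ε + 2 * δ) (q₁ := 3 * ε + 10 * δ) (q₂ := (M : ℝ) * ε / 4 + 9 * δ)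
    (R := (M : ℝ) * ε / 4 + 17 * δ) (by linarith) (by linarith) (by linarith) (by linarith)
    ⟨triMeshPoint δ c - z, hmem γ₁ hz, by rw [hnorm]; linarith⟩
    ⟨triMeshPoint δ c - z', hmem γ₁ hz', by rw [hnorm]; exact haz'⟩
    ⟨triMeshPoint δ c - y, hmem γ₂ hy, by rw [hnorm]; linarith⟩
    ⟨triMeshPoint δ c - y', hmem γ₂ hy', by rw [hnorm]; exact hay'⟩
    ?_ (by linarith) hr
  -- the inner radius: `3ε + 19δ ≤ (3/4) (5ε) ≤ (√3/2) (δ r₁)`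
  have h1 : Real.sqrt 3 / 2 * (5 * ε) ≤ Real.sqrt 3 / 2 * (δ * r₁) :=
    mul_le_mul_of_nonneg_left hr₁ (by positivity)
  have h2 : (3 / 2 : ℝ) / 2 * (5 * ε) ≤ Real.sqrt 3 / 2 * (5 * ε) := by
    apply mul_le_mul_of_nonneg_right _ (by positivity)
    linarith
  linarith

end Summit.CriticalPhenomena.CardyFormulaZ2.Cruxes.MagicFormulaT.LineSketch

end
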